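import Literature.Computability.Complexity.Space
import Literature.Computability.Complexity.FlatPrograms
import HarnessLib

/-!
# Space machines as flat programs: the machine side of the bounded-halting problem for `PSPACE`

Third stage of the tree's universal machine for space-bounded computation, after
`PolyTimeCountable.lean` (`TM2Std.stdCode`: every `Turing.FinTM2` is simulated step for step by a
standard machine with `Fin` types) and `FlatPrograms.lean` (`FlatProg.compile`: the statement
trees of a standard machine become a flat program of `goto`/`push`/`pop` instructions on a program
counter and stacks of symbol numbers, `FlatProg.runs_code`/`runs_step`). Here the two are composed
with the space machines of `Space.lean` (`SpaceMachine`, `DecidesInSpace`, `PSPACE`; Arora–Barak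
2009, Def. 4.1/4.5) and the RESOURCE side of the simulation is established — what a polynomial-space
universal simulation (Homer–Selman 2011, §7.5.1: the machines `PS_k` and the `≤ᵖₘ`-complete set
`𝒰_PS = {⟨i, x, 0^l⟩ | PS_i accepts x in space ≤ l}`, Homework 7.13; Arora–Barak 2009, §4.2,
`SPACE TMSAT`) needs to know about the simulated run:

* `FlatProg.sz` (total number of stack symbols) grows by at most one per flat step
  (`sz_step_le`, `sz_iterate_le`); symbol bounds `StkBound` are preserved by programs with
  bounded pushes (`StkBound.step`, `pushBound_compile`); the number of stacks is invariant;
* `FlatProg.runs_code_le`, `FlatProg.runs_step_le` — `runs_code`/`runs_step` of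
  `FlatPrograms.lean` with the step count recorded: one statement `q` is simulated in at most
  `csize q` flat steps, one machine step in at most `|program|` flat steps;
* `FlatProg.exists_reaches_of_iterate` — **segment decomposition**: every flat configuration
  reached from the code of a machine configuration `a` lies at most `|program|` steps into the
  segment of a machine configuration reachable from `a`; hence (`sz_iterate_trCfg_le`) a bound `Z`
  on the stacks of all reachable machine configurations bounds every flat configuration by
  `Z + |program|`, the program counter stays `≤ |program|` (`fst_iterate_trCfg_le`) and the
  symbols stay in the alphabet (`stkBound_iterate_trCfg`);
* `SpaceMachine.stkTotal_le_of_reaches` — along a run of a decider in space `S` the stacks hold at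
  most `S x + |x|` symbols (work space plus the read-only input, `IsInputPreserving`);
  `SpaceMachine.trCfg_init` — the flat code of the initial configuration is
  `(entry main init, initStk K k₀ code x)`; `SpaceMachine.flat_halts` — the flat run halts
  (program counter `= |program|`, fixed from then on) with output stack `[accCode]` iff `x ∈ L`
  (the answer symbol of the halting configuration is allowed, so its code determines it);
* `FlatProg.FlatWitness L`, **`FlatProg.exists_flatWitness`** — the package: every `L ∈ PSPACE`
  has a flat program `P`, stack count `K`, alphabet bound `N`, start `pc₀`, input/output stacks,
  letter codes and an accepting symbol such that the run from `(pc₀, initStk K k₀ code x)` keeps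
  `≤ bound(|x|)` symbols (a polynomial), program counter `≤ |P|`, symbols `≤ N`, `K` stacks, and
  halts accepting iff `x ∈ L`.

With a polynomial-time universal STEP function on string codes of flat configurations (the sequel
announced in `FlatPrograms.lean`) this is exactly what makes the bounded-halting language of flat
programs `PSPACE`-hard (reduction `x ↦ ⟨P, (pc₀, initStk …), 1^{bound |x|}⟩`), and, iterated by the
loop machine of `SpaceLoop.lean`, a member of `PSPACE`; that assembly discharges
`exists_isComplete_PSPACE` (`SpaceOracles.lean`) and is not in this file. Nothing here is specific
to one string coding: all statements are about `FlatProg.Prog`/`FlatProg.Cfg`.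

Mathlib has no space-bounded machines and no universal machine (see the module docstrings of
`Space.lean`, `UniversalTM2.lean`, `FlatPrograms.lean`).

## References

* S. Arora, B. Barak, *Computational Complexity: A Modern Approach*, CUP 2009, §1.4 (machines as
  strings, efficient universal machine, Thm. 1.9), Def. 4.1 (space-bounded computation: only work
  tapes are charged, read-only input), Thm. 4.2, §4.2 (`SPACE TMSAT`) [AroraBarakCC2009].
* S. Homer, A. L. Selman, *Computability and Complexity Theory*, 2nd ed., Springer 2011, §7.5.1
  (Prop. 7.7, the machines `PS_k`; `𝒰_PS`, Homework 7.13) [HomerSelman2011] (held, p. 158).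
* Mathlib `Mathlib/Computability/TuringMachine/StackTuringMachine.lean` (`Turing.TM2.stepAux`).
-/

namespace Literature.Computability.Complexity

namespace FlatProg

open Turing TM2Std Function StateTransition
open UnivTM2 (encStk encStk_getD encStk_update)

/-! ### The total stack size of a flat configuration grows by at most one symbol per step -/

/-- The total number of symbols on the stacks of a flat configuration. [folklore] -/
def sz (S : List (List ℕ)) : ℕ := (S.map List.length).sum

/-- `sz` of a cons. [folklore] -/
@[simp] theorem sz_cons (l : List ℕ) (S : List (List ℕ)) : sz (l :: S) = l.length + sz S := by
  simp [sz]

/-- `sz []`. [folklore] -/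
@[simp] theorem sz_nil : sz [] = 0 := rfl

/-- Pushing one symbol raises the total size by at most one. [folklore] -/
theorem sz_modify_cons_le (a : ℕ) : ∀ (S : List (List ℕ)) (k : ℕ),
    sz (S.modify k (fun l => a :: l)) ≤ sz S + 1
  | [], k => by simp
  | l :: S, 0 => by
    rw [List.modify_zero_cons, sz_cons, sz_cons, List.length_cons]
    omega
  | l :: S, k + 1 => by
    rw [List.modify_succ_cons, sz_cons, sz_cons]
    have := sz_modify_cons_le a S k
    omega

/-- Writing a list that is no longer than the old entry does not raise the total size.
[folklore] -/
theorem sz_set_le : ∀ (S : List (List ℕ)) (k : ℕ) (l : List ℕ), l.length ≤ (S.getD k []).length →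
    sz (S.set k l) ≤ sz S
  | [], k, l, _ => by simp
  | l' :: S, 0, l, h => by simp at h ⊢; omega
  | l' :: S, k + 1, l, h => by
    rw [List.set_cons_succ, sz_cons, sz_cons]
    have := sz_set_le S k l (by simpa using h)
    omega

/-- Executing one instruction raises the total size by at most one. [folklore] -/
theorem sz_apply_le (i : Instr) (S : List (List ℕ)) : sz (i.apply S).2 ≤ sz S + 1 := by
  cases i with
  | goto j => simp [Instr.apply]
  | push k a j => exact sz_modify_cons_le a S k
  | pop k t =>
    rw [Instr.apply]
    exact (sz_set_le S k _ (by simp)).trans (Nat.le_succ _)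

/-- **One flat step raises the total stack size by at most one symbol.** [folklore] -/
theorem sz_step_le (P : Prog) (c : Cfg) : sz (step P c).2 ≤ sz c.2 + 1 := by
  unfold step
  cases P[c.1]? with
  | none => exact Nat.le_succ _
  | some i => exact sz_apply_le i c.2

/-- Hence `m` flat steps raise it by at most `m`. [folklore] -/
theorem sz_iterate_le (P : Prog) (c : Cfg) (m : ℕ) : sz ((step P)^[m] c).2 ≤ sz c.2 + m := by
  induction m with
  | zero => simp
  | succ m ih =>
    rw [iterate_succ_apply']
    have := sz_step_le P ((step P)^[m] c)
    omega

/-! ### Symbol bounds are preserved -/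

/-- Every `push` instruction of the program pushes a symbol `≤ N`. [folklore] -/
def PushBound (N : ℕ) (P : Prog) : Prop :=
  ∀ i ∈ P, ∀ k a j, i = Instr.push k a j → a ≤ N

/-- Every symbol on every stack is `≤ N`. [folklore] -/
def StkBound (N : ℕ) (S : List (List ℕ)) : Prop :=
  ∀ l ∈ S, ∀ a ∈ l, a ≤ N

/-- `StkBound` is preserved by `modify` with a bounded cons. [folklore] -/
theorem StkBound.modify_cons {N a : ℕ} (ha : a ≤ N) :
    ∀ {S : List (List ℕ)}, StkBound N S → ∀ k : ℕ, StkBound N (S.modify k (fun l => a :: l))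
  | [], _, k => by intro l hl; simp at hl
  | l :: S, h, 0 => by
    rw [List.modify_zero_cons]
    intro l' hl' b hb
    rcases List.mem_cons.1 hl' with rfl | hl'
    · rcases List.mem_cons.1 hb with rfl | hb
      · exact ha
      · exact h l List.mem_cons_self b hb
    · exact h l' (List.mem_cons_of_mem _ hl') b hb
  | l :: S, h, k + 1 => by
    rw [List.modify_succ_cons]
    intro l' hl' b hb
    rcases List.mem_cons.1 hl' with rfl | hl'
    · exact h l' List.mem_cons_self b hb
    · exact StkBound.modify_cons ha (fun l'' hl'' => h l'' (List.mem_cons_of_mem _ hl'')) k l' hl' b hb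

/-- `StkBound` is preserved by writing a sublist-of-an-entry tail. [folklore] -/
theorem StkBound.set_tail {N : ℕ} {S : List (List ℕ)} (h : StkBound N S) (k : ℕ) :
    StkBound N (S.set k (S.getD k []).tail) := by
  intro l hl b hb
  rcases List.mem_or_eq_of_mem_set hl with hl | rfl
  · exact h l hl b hb
  · have hk : (S.getD k []) ∈ S ∨ S.getD k [] = [] := by
      rw [List.getD_eq_getElem?_getD]
      cases hS : S[k]? with
      | none => exact Or.inr rfl
      | some l₀ => exact Or.inl (List.mem_of_getElem? hS)
    rcases hk with hk | hk
    · exact h _ hk b (List.mem_of_mem_tail hb)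
    · rw [hk] at hb; cases hb

/-- **A step of a program with bounded pushes keeps the stack symbols bounded.** [folklore] -/
theorem StkBound.step {N : ℕ} {P : Prog} (hP : PushBound N P) {c : Cfg} (h : StkBound N c.2) :
    StkBound N (step P c).2 := by
  unfold FlatProg.step
  cases hi : P[c.1]? with
  | none => exact h
  | some i =>
    cases i with
    | goto j => exact h
    | push k a j => exact StkBound.modify_cons (hP _ (List.mem_of_getElem? hi) k a j rfl) h k
    | pop k t => exact h.set_tail k

/-- Hence all iterates. [folklore] -/
theorem StkBound.iterate {N : ℕ} {P : Prog} (hP : PushBound N P) {c : Cfg} (h : StkBound N c.2)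
    (m : ℕ) : StkBound N ((FlatProg.step P)^[m] c).2 := by
  induction m with
  | zero => exact h
  | succ m ih => rw [iterate_succ_apply']; exact ih.step hP

/-- The number of stacks never changes. [folklore] -/
theorem length_apply (i : Instr) (S : List (List ℕ)) : (i.apply S).2.length = S.length := by
  cases i <;> simp [Instr.apply]

/-- The number of stacks never changes under a step. [folklore] -/
theorem length_step (P : Prog) (c : Cfg) : (step P c).2.length = c.2.length := by
  unfold step
  cases P[c.1]? with
  | none => rfl
  | some i => exact length_apply i c.2

/-- The number of stacks never changes under iteration. [folklore] -/
theorem length_iterate (P : Prog) (c : Cfg) (m : ℕ) : ((step P)^[m] c).2.length = c.2.length := by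
  induction m with
  | zero => rfl
  | succ m ih => rw [iterate_succ_apply', length_step, ih]

/-! ### Runs of bounded length inside the program -/

/-- `RunsLe P B a b`: iterating `step P` from `a` reaches `b` in at most `B` steps, every
configuration met strictly before the end having its program counter inside the program
(`Runs` with a length bound). [folklore] -/
def RunsLe (P : Prog) (B : ℕ) (a b : Cfg) : Prop :=
  ∃ n, n ≤ B ∧ (step P)^[n] a = b ∧ ∀ m < n, ((step P)^[m] a).1 < P.length

/-- `RunsPosLe P B a b`: as `RunsLe`, in at least one step (`RunsPos` with a length bound).
[folklore] -/
def RunsPosLe (P : Prog) (B : ℕ) (a b : Cfg) : Prop :=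
  ∃ n, 0 < n ∧ n ≤ B ∧ (step P)^[n] a = b ∧ ∀ m < n, ((step P)^[m] a).1 < P.length

/-- Zero steps. [folklore] -/
theorem RunsLe.refl (P : Prog) (B : ℕ) (a : Cfg) : RunsLe P B a a :=
  ⟨0, Nat.zero_le _, rfl, fun m hm => absurd hm (Nat.not_lt_zero m)⟩

/-- One step from a fetchable address. [folklore] -/
theorem RunsPosLe.single {P : Prog} {a : Cfg} {i : Instr} (h : P[a.1]? = some i) :
    RunsPosLe P 1 a (i.apply a.2) :=
  ⟨1, Nat.one_pos, le_rfl, by rw [iterate_one, step_of_getElem? h], fun m hm => by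
    have hm0 : m = 0 := by omega
    subst hm0
    exact (List.getElem?_eq_some_iff.1 h).1⟩

/-- Weakening the bound. [folklore] -/
theorem RunsLe.mono {P : Prog} {B B' : ℕ} {a b : Cfg} (h : RunsLe P B a b) (hB : B ≤ B') :
    RunsLe P B' a b := by
  obtain ⟨n, hn, e, p⟩ := h
  exact ⟨n, hn.trans hB, e, p⟩

/-- Weakening the bound. [folklore] -/
theorem RunsPosLe.mono {P : Prog} {B B' : ℕ} {a b : Cfg} (h : RunsPosLe P B a b) (hB : B ≤ B') :
    RunsPosLe P B' a b := by
  obtain ⟨n, hn₀, hn, e, p⟩ := h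
  exact ⟨n, hn₀, hn.trans hB, e, p⟩

/-- A bounded positive run followed by a bounded run. [folklore] -/
theorem RunsPosLe.trans_runsLe {P : Prog} {B₁ B₂ : ℕ} {a b c : Cfg} (h₁ : RunsPosLe P B₁ a b)
    (h₂ : RunsLe P B₂ b c) : RunsPosLe P (B₁ + B₂) a c := by
  obtain ⟨n₁, hn₁, hB₁, e₁, p₁⟩ := h₁
  obtain ⟨n₂, hB₂, e₂, p₂⟩ := h₂
  refine ⟨n₂ + n₁, by omega, by omega, by rw [iterate_add_apply, e₁, e₂], fun m hm => ?_⟩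
  by_cases hm₁ : m < n₁
  · exact p₁ m hm₁
  · obtain ⟨d, rfl⟩ := Nat.exists_eq_add_of_le (le_of_not_gt hm₁)
    rw [add_comm n₁ d, iterate_add_apply, e₁]
    exact p₂ d (by omega)

/-- Forgetting positivity. [folklore] -/
theorem RunsPosLe.runsLe {P : Prog} {B : ℕ} {a b : Cfg} (h : RunsPosLe P B a b) : RunsLe P B a b := by
  obtain ⟨n, -, hn, e, p⟩ := h
  exact ⟨n, hn, e, p⟩

/-- Forgetting the bound. [folklore] -/
theorem RunsPosLe.runsPos {P : Prog} {B : ℕ} {a b : Cfg} (h : RunsPosLe P B a b) : RunsPos P a b := by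
  obtain ⟨n, hn₀, -, e, p⟩ := h
  exact ⟨n, hn₀, e, p⟩

/-! ### Simulation of one statement, with the length bound `csize` -/

section Compile

variable {nK N nΛ nσ : ℕ} {E : Fin nΛ → Fin nσ → ℕ} {H : ℕ}

/-- **Simulation of one statement in at most `csize` flat steps** (`runs_code` of
`FlatPrograms.lean` with the step count recorded: every state block contributes at least the one
or two instructions executed in it). [cite: AroraBarakCC2009, §1.4 (machines as strings)] -/
theorem runs_code_le {P : Prog} : ∀ (q : SStmt nK N nΛ nσ) (base : ℕ), Placed E H P q base →
    ∀ (s : Fin nσ) (S : Fin nK → List (Fin (N + 1))),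
      RunsPosLe P (csize q) (addr q s base, encStk S)
        (fin (E := E) (H := H) (TM2.stepAux q.toStmt s S))
  | .push k f q, base, hP, s, S => by
    have hq : Placed E H P q (base + nσ) :=
      placed_of_append hP _ [] (by rw [code, List.append_nil]) (by rw [length_blocks₁])
        (by rw [length_blocks₁, csize])
    have hfetch : P[(addr (.push k f q) s base, encStk S).1]? =
        some (Instr.push k.val (f s).val (addr q s (base + nσ))) := by
      show P[base + s.val * 1]? = _
      rw [hP.getElem? (by rw [csize]; have := s.isLt; omega), code, getElem?_blocks₁]
    refine ((RunsPosLe.single hfetch).trans_runsLe (B₂ := csize q) ?_).mono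
      (by rw [csize]; have := s.pos; omega)
    dsimp only
    rw [Instr.apply, modify_encStk]
    simpa only [SStmt.toStmt, TM2.stepAux] using (runs_code_le q (base + nσ) hq s _).runsLe
  | .peek k f q, base, hP, s, S => by
    have hq : Placed E H P q (base + nσ * (N + 2)) :=
      placed_of_append hP _ [] (by rw [code, List.append_nil]) (by rw [length_blocksP])
        (by rw [length_blocksP, csize])
    have hfetch : P[(addr (.peek k f q) s base, encStk S).1]? =
        some (Instr.pop k.val ((addr q (f s none) (base + nσ * (N + 2))) ::
          List.ofFn fun a : Fin (N + 1) => base + s.val * (N + 2) + (a.val + 1))) := by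
      show P[base + s.val * (N + 2)]? = _
      rw [hP.getElem? (by rw [csize]; have h := block_lt s.isLt (show 0 < N + 2 by omega) (csize q); omega),
        code, getElem?_blocksP_zero]
    have h2 : 1 + (1 + csize q) ≤ csize (SStmt.peek k f q) := by
      rw [csize]
      have : 1 * 2 ≤ nσ * (N + 2) := Nat.mul_le_mul s.pos (by omega)
      omega
    refine ((RunsPosLe.single hfetch).trans_runsLe (B₂ := 1 + csize q) ?_).mono (by omega)
    dsimp only
    rw [Instr.apply, encStk_getD, tblIdx_head?_map]
    cases hS : S k with
    | nil =>
      have hset : (encStk S).set k.val (List.map Fin.val ([] : List (Fin (N + 1)))).tail =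
          encStk S := by
        rw [List.map_nil, List.tail_nil, show ([] : List ℕ) = List.map Fin.val ([] : List (Fin (N + 1)))
          from rfl, ← encStk_update, update_eq_self_iff.2 hS.symm]
      rw [hset]
      have := ((runs_code_le q (base + nσ * (N + 2)) hq (f s none) S).runsLe).mono
        (show csize q ≤ 1 + csize q by omega)
      simpa only [SStmt.toStmt, TM2.stepAux, hS, List.head?_nil, Option.elim,
        List.getD_cons_zero] using this
    | cons a L =>
      have hidx : (addr q (f s none) (base + nσ * (N + 2)) ::
          List.ofFn fun a : Fin (N + 1) => base + s.val * (N + 2) + (a.val + 1)).getD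
            ((a :: L).head?.elim 0 fun a => a.val + 1) 0 = base + s.val * (N + 2) + (a.val + 1) := by
        show (_ :: List.ofFn fun a : Fin (N + 1) => base + s.val * (N + 2) + (a.val + 1))[a.val + 1]?.getD 0 = _
        rw [List.getElem?_cons_succ, List.getElem?_ofFn, dif_pos a.isLt]
        rfl
      rw [hidx, List.map_cons, List.tail_cons, ← encStk_update]
      -- the push-back
      have hfetch' : P[(base + s.val * (N + 2) + (a.val + 1), encStk (update S k L)).1]? =
          some (Instr.push k.val a.val (addr q (f s (some a)) (base + nσ * (N + 2)))) := by
        show P[base + s.val * (N + 2) + (a.val + 1)]? = _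
        rw [Nat.add_assoc, hP.getElem? (by rw [csize]; exact block_lt s.isLt (show a.val + 1 < N + 2 by omega) _),
          code, getElem?_blocksP_succ]
      refine ((RunsPosLe.single hfetch').trans_runsLe ?_).runsLe
      dsimp only
      rw [Instr.apply, modify_encStk, update_self, update_idem, ← hS, update_eq_self]
      have := (runs_code_le q (base + nσ * (N + 2)) hq (f s (some a)) S).runsLe
      simpa only [SStmt.toStmt, TM2.stepAux, hS, List.head?_cons] using this
  | .pop k f q, base, hP, s, S => by
    have hq : Placed E H P q (base + nσ) :=
      placed_of_append hP _ [] (by rw [code, List.append_nil]) (by rw [length_blocks₁])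
        (by rw [length_blocks₁, csize])
    have hfetch : P[(addr (.pop k f q) s base, encStk S).1]? =
        some (Instr.pop k.val (tblOf fun o => addr q (f s o) (base + nσ))) := by
      show P[base + s.val * 1]? = _
      rw [hP.getElem? (by rw [csize]; have := s.isLt; omega), code, getElem?_blocks₁]
    refine ((RunsPosLe.single hfetch).trans_runsLe (B₂ := csize q) ?_).mono
      (by rw [csize]; have := s.pos; omega)
    dsimp only
    rw [Instr.apply, encStk_getD, tblIdx_head?_map, getD_tblOf, ← List.map_tail, ← encStk_update]
    simpa only [SStmt.toStmt, TM2.stepAux] using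
      (runs_code_le q (base + nσ) hq (f s (S k).head?) _).runsLe
  | .load f q, base, hP, s, S => by
    have hq : Placed E H P q (base + nσ) :=
      placed_of_append hP _ [] (by rw [code, List.append_nil]) (by rw [length_blocks₁])
        (by rw [length_blocks₁, csize])
    have hfetch : P[(addr (.load f q) s base, encStk S).1]? =
        some (Instr.goto (addr q (f s) (base + nσ))) := by
      show P[base + s.val * 1]? = _
      rw [hP.getElem? (by rw [csize]; have := s.isLt; omega), code, getElem?_blocks₁]
    refine ((RunsPosLe.single hfetch).trans_runsLe (B₂ := csize q) ?_).mono
      (by rw [csize]; have := s.pos; omega)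
    dsimp only
    rw [Instr.apply]
    simpa only [SStmt.toStmt, TM2.stepAux] using (runs_code_le q (base + nσ) hq (f s) S).runsLe
  | .branch p q₁ q₂, base, hP, s, S => by
    have hq₁ : Placed E H P q₁ (base + nσ) :=
      placed_of_append hP _ (code E H q₂ (base + nσ + csize q₁)) (by rw [code])
        (by rw [length_blocks₁]) (by rw [length_blocks₁, csize]; omega)
    have hq₂ : Placed E H P q₂ (base + nσ + csize q₁) :=
      placed_of_append hP (_ ++ code E H q₁ (base + nσ)) []
        (by rw [code, List.append_nil, List.append_assoc])
        (by rw [List.length_append, length_blocks₁, length_code, Nat.add_assoc])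
        (by rw [List.length_append, length_blocks₁, length_code, csize])
    have hfetch : P[(addr (.branch p q₁ q₂) s base, encStk S).1]? =
        some (Instr.goto (if p s then addr q₁ s (base + nσ) else addr q₂ s (base + nσ + csize q₁))) := by
      show P[base + s.val * 1]? = _
      rw [hP.getElem? (by rw [csize]; have := s.isLt; omega), code, getElem?_blocks₁]
    refine ((RunsPosLe.single hfetch).trans_runsLe (B₂ := csize q₁ + csize q₂) ?_).mono
      (by rw [csize]; have := s.pos; omega)
    dsimp only
    rw [Instr.apply]
    cases hp : p s
    · simpa only [SStmt.toStmt, TM2.stepAux, hp, cond_false, Bool.false_eq_true, if_false] using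
        ((runs_code_le q₂ (base + nσ + csize q₁) hq₂ s S).runsLe).mono (Nat.le_add_left _ _)
    · simpa only [SStmt.toStmt, TM2.stepAux, hp, cond_true, if_true] using
        ((runs_code_le q₁ (base + nσ) hq₁ s S).runsLe).mono (Nat.le_add_right _ _)
  | .goto f, base, hP, s, S => by
    have hfetch : P[(addr (SStmt.goto f : SStmt nK N nΛ nσ) s base, encStk S).1]? =
        some (Instr.goto (E (f s) s)) := by
      show P[base + s.val * 1]? = _
      rw [hP.getElem? (by rw [csize]; have := s.isLt; omega), code, Nat.mul_one, List.getElem?_ofFn,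
        dif_pos s.isLt]
    refine ((RunsPosLe.single hfetch).trans_runsLe (RunsLe.refl P 0 _)).mono ?_
    rw [csize]; exact s.pos
  | .halt, base, hP, s, S => by
    have hfetch : P[(addr (SStmt.halt : SStmt nK N nΛ nσ) s base, encStk S).1]? =
        some (Instr.goto H) := by
      show P[base + s.val * 1]? = _
      rw [hP.getElem? (by rw [csize]; have := s.isLt; omega), code, Nat.mul_one, List.getElem?_ofFn,
        dif_pos s.isLt]
    refine ((RunsPosLe.single hfetch).trans_runsLe (RunsLe.refl P 0 _)).mono ?_
    rw [csize]; exact s.pos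

/-- Every `push` of the code of a statement pushes a symbol of the alphabet `Fin (N + 1)`.
[folklore] -/
theorem pushBound_code : ∀ (q : SStmt nK N nΛ nσ) (base : ℕ), PushBound N (code E H q base)
  | .push k f q, base => by
    intro i hi k' a j h
    rw [code, List.mem_append] at hi
    rcases hi with hi | hi
    · simp only [blocks₁, List.mem_flatten, List.mem_ofFn] at hi
      obtain ⟨l, ⟨s, rfl⟩, hl⟩ := hi
      rw [List.mem_singleton] at hl
      rw [hl] at h
      cases h
      exact Nat.le_of_lt_succ (f s).isLt
    · exact pushBound_code q _ i hi k' a j h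
  | .peek k f q, base => by
    intro i hi k' a j h
    rw [code, List.mem_append] at hi
    rcases hi with hi | hi
    · simp only [blocksP, List.mem_flatten, List.mem_ofFn] at hi
      obtain ⟨l, ⟨s, rfl⟩, hl⟩ := hi
      rcases List.mem_cons.1 hl with hl | hl
      · rw [hl] at h; cases h
      · rw [List.mem_ofFn] at hl
        obtain ⟨a', rfl⟩ := hl
        cases h
        exact Nat.le_of_lt_succ a'.isLt
    · exact pushBound_code q _ i hi k' a j h
  | .pop k f q, base => by
    intro i hi k' a j h
    rw [code, List.mem_append] at hi
    rcases hi with hi | hi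
    · simp only [blocks₁, List.mem_flatten, List.mem_ofFn] at hi
      obtain ⟨l, ⟨s, rfl⟩, hl⟩ := hi
      rw [List.mem_singleton] at hl
      rw [hl] at h; cases h
    · exact pushBound_code q _ i hi k' a j h
  | .load f q, base => by
    intro i hi k' a j h
    rw [code, List.mem_append] at hi
    rcases hi with hi | hi
    · simp only [blocks₁, List.mem_flatten, List.mem_ofFn] at hi
      obtain ⟨l, ⟨s, rfl⟩, hl⟩ := hi
      rw [List.mem_singleton] at hl
      rw [hl] at h; cases h
    · exact pushBound_code q _ i hi k' a j h
  | .branch p q₁ q₂, base => by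
    intro i hi k' a j h
    rw [code, List.mem_append, List.mem_append] at hi
    rcases hi with hi | hi | hi
    · simp only [blocks₁, List.mem_flatten, List.mem_ofFn] at hi
      obtain ⟨l, ⟨s, rfl⟩, hl⟩ := hi
      rw [List.mem_singleton] at hl
      rw [hl] at h; cases h
    · exact pushBound_code q₁ _ i hi k' a j h
    · exact pushBound_code q₂ _ i hi k' a j h
  | .goto f, base => by
    intro i hi k' a j h
    rw [code, List.mem_ofFn] at hi
    obtain ⟨s, rfl⟩ := hi
    cases h
  | .halt, base => by
    intro i hi k' a j h
    rw [code, List.mem_ofFn] at hi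
    obtain ⟨s, rfl⟩ := hi
    cases h

end Compile

/-! ### Machines: bounded simulation of steps, and the segment decomposition of flat runs -/

section Machine

variable (c : SCode)

/-- The code size of every label is at most the program length `haltAddr`. [folklore] -/
theorem csize_le_haltAddr (l : Fin c.nΛ) : csize (nσ := c.nσ) (c.prog l) ≤ haltAddr c := by
  rw [haltAddr]
  have hl : csize (nσ := c.nσ) (c.prog l) ∈ sizes c := by
    rw [sizes, List.mem_ofFn]; exact ⟨l, rfl⟩
  exact List.le_sum_of_mem hl

/-- **One machine step takes at most `|program|` flat steps.** [cite: AroraBarakCC2009, §1.4 (machines as strings)] -/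
theorem runs_step_le {a b : c.tm.Cfg} (h : c.tm.step a = some b) :
    RunsPosLe (compile c) (compile c).length (trCfg c a) (trCfg c b) := by
  obtain ⟨_ | l, v, S⟩ := a
  · cases h
  · cases h
    rw [length_compile]
    exact (runs_code_le (c.prog l) (off c l) (placed_prog c l) v S).mono (csize_le_haltAddr c l)

/-- The compiled program pushes only symbols of its alphabet. [folklore] -/
theorem pushBound_compile : PushBound c.N (compile c) := by
  intro i hi k a j h
  rw [compile, List.mem_flatten] at hi
  obtain ⟨l, hl, hil⟩ := hi
  rw [List.mem_ofFn] at hl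
  obtain ⟨l', rfl⟩ := hl
  exact pushBound_code _ _ i hil k a j h

/-- Coded stacks carry symbols of the alphabet only. [folklore] -/
theorem stkBound_encStk {nK N : ℕ} (S : Fin nK → List (Fin (N + 1))) : StkBound N (encStk S) := by
  intro l hl a ha
  rw [UnivTM2.encStk, List.mem_ofFn] at hl
  obtain ⟨k, rfl⟩ := hl
  rw [List.mem_map] at ha
  obtain ⟨x, -, rfl⟩ := ha
  exact Nat.le_of_lt_succ x.isLt

/-- **Segment decomposition of a flat run.** Every flat configuration reached from the code of a
machine configuration `a` lies at most `|program|` flat steps into the segment of some machine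
configuration `e` reachable from `a`. [cite: AroraBarakCC2009, §1.4 (machines as strings)] -/
theorem exists_reaches_of_iterate (a : c.tm.Cfg) (m : ℕ) :
    ∃ e : c.tm.Cfg, Reaches c.tm.step a e ∧ ∃ j ≤ (compile c).length,
      (step (compile c))^[m] (trCfg c a) = (step (compile c))^[j] (trCfg c e) ∧
      ((c.tm.step e = none ∧ j = 0) ∨
        ∃ b n, c.tm.step e = some b ∧ j < n ∧ n ≤ (compile c).length ∧
          (step (compile c))^[n] (trCfg c e) = trCfg c b ∧
          ∀ m' < n, ((step (compile c))^[m'] (trCfg c e)).1 < (compile c).length) := by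
  -- the data attached to a fresh machine configuration `e` (offset `0` into its segment)
  have fresh : ∀ e : c.tm.Cfg, (c.tm.step e = none ∧ (0 : ℕ) = 0) ∨
      ∃ b n, c.tm.step e = some b ∧ 0 < n ∧ n ≤ (compile c).length ∧
        (step (compile c))^[n] (trCfg c e) = trCfg c b ∧
        ∀ m' < n, ((step (compile c))^[m'] (trCfg c e)).1 < (compile c).length := by
    intro e
    cases he : c.tm.step e with
    | none => exact Or.inl ⟨rfl, rfl⟩
    | some b =>
      obtain ⟨n, hn₀, hn, hrun, hlt⟩ := runs_step_le c he
      exact Or.inr ⟨b, n, rfl, hn₀, hn, hrun, hlt⟩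
  induction m with
  | zero => exact ⟨a, Relation.ReflTransGen.refl, 0, Nat.zero_le _, rfl, fresh a⟩
  | succ m ih =>
    obtain ⟨e, hae, j, hj, hm, hcase⟩ := ih
    rcases hcase with ⟨hnone, rfl⟩ | ⟨b, n, hsome, hjn, hn, hrun, hlt⟩
    · -- `e` is halted: its code is a fixed point
      refine ⟨e, hae, 0, Nat.zero_le _, ?_, Or.inl ⟨hnone, rfl⟩⟩
      rw [iterate_succ_apply', hm, iterate_zero, id_eq, step_trCfg_of_none c hnone]
    · by_cases hj1 : j + 1 < n
      · -- still inside the segment of `e`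
        refine ⟨e, hae, j + 1, by omega, ?_, Or.inr ⟨b, n, hsome, hj1, hn, hrun, hlt⟩⟩
        rw [iterate_succ_apply', hm, ← iterate_succ_apply' (step (compile c)) j]
      · -- the segment of `e` is complete: move on to `b`
        obtain rfl : n = j + 1 := by omega
        refine ⟨b, hae.tail hsome, 0, Nat.zero_le _, ?_, fresh b⟩
        rw [iterate_succ_apply'] at hrun
        rw [iterate_succ_apply', hm, hrun]
        rfl

/-- **Size of flat configurations along a simulated run**: if every machine configuration
reachable from `a` has at most `Z` symbols on its stacks, every flat configuration reached from the
code of `a` has at most `Z + |program|` symbols. [cite: AroraBarakCC2009, §1.4 (machines as strings)] -/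
theorem sz_iterate_trCfg_le {a : c.tm.Cfg} {Z : ℕ}
    (hZ : ∀ e : c.tm.Cfg, Reaches c.tm.step a e → sz (encStk e.stk) ≤ Z) (m : ℕ) :
    sz ((step (compile c))^[m] (trCfg c a)).2 ≤ Z + (compile c).length := by
  obtain ⟨e, hae, j, hj, hm, -⟩ := exists_reaches_of_iterate c a m
  rw [hm]
  have h1 := sz_iterate_le (compile c) (trCfg c e) j
  have h2 := hZ e hae
  rw [trCfg_snd] at h1
  omega

/-- **The flat program counter never exceeds the program length** along a simulated run.
[folklore] -/
theorem fst_iterate_trCfg_le (a : c.tm.Cfg) (m : ℕ) :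
    ((step (compile c))^[m] (trCfg c a)).1 ≤ (compile c).length := by
  obtain ⟨e, -, j, -, hm, hcase⟩ := exists_reaches_of_iterate c a m
  rw [hm]
  rcases hcase with ⟨hnone, rfl⟩ | ⟨b, n, -, hjn, -, -, hlt⟩
  · rw [iterate_zero, id_eq, trCfg_fst_of_none c ((step_eq_none_iff c e).1 hnone), length_compile]
  · exact (hlt j hjn).le

/-- Stack symbols stay in the alphabet along a simulated run. [folklore] -/
theorem stkBound_iterate_trCfg (a : c.tm.Cfg) (m : ℕ) :
    StkBound c.N ((step (compile c))^[m] (trCfg c a)).2 :=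
  StkBound.iterate (pushBound_compile c) (by rw [trCfg_snd]; exact stkBound_encStk _) m

/-- The number of stacks is `nK` along a simulated run. [folklore] -/
theorem length_iterate_trCfg (a : c.tm.Cfg) (m : ℕ) :
    ((step (compile c))^[m] (trCfg c a)).2.length = c.nK := by
  rw [length_iterate, trCfg_snd, UnivTM2.encStk, List.length_ofFn]

end Machine

/-! ### Initial stacks of a flat presentation -/

/-- The initial stacks of a flat program run on the input word `x`: `K` stacks, all empty except
stack `k₀`, which holds `x` coded letter by letter by `code`. [cite: AroraBarakCC2009, §1.4 (machines as strings)] -/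
def initStk (K k₀ : ℕ) (code : Bool → ℕ) (x : List Bool) : List (List ℕ) :=
  List.ofFn fun k : Fin K => if k.val = k₀ then x.map code else []

/-- The initial stacks are `K` many. [folklore] -/
@[simp] theorem length_initStk (K k₀ : ℕ) (code : Bool → ℕ) (x : List Bool) :
    (initStk K k₀ code x).length = K := by
  simp [initStk]

end FlatProg

/-! ### Space machines: total stack size of reachable configurations -/

namespace SpaceMachine

open Turing TM2Std FlatProg Function StateTransition _root_.Computability
open UnivTM2 (encStk encStk_getD encStk_update)

variable (M : SpaceMachine Bool Bool)

/-- The total number of symbols on all stacks (input stacks included) of a stack assignment of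
the machine. [folklore] -/
noncomputable def stkTotal (S : ∀ k, List (M.tm.Γ k)) : ℕ :=
  haveI := M.tm.kFin
  ∑ k, (S k).length

/-- Total size = work space + the two halves of the read-only input. [cite: AroraBarakCC2009, Def. 4.1 (only work tapes are charged)] -/
theorem stkTotal_eq (c : M.tm.Cfg) :
    M.stkTotal c.stk = M.workSpace c + (c.stk M.tm.k₀).length + (c.stk M.kL).length := by
  letI := M.tm.kFin
  have h1 := Finset.add_sum_erase (Finset.univ : Finset M.tm.K) (fun k => (c.stk k).length)
    (Finset.mem_univ M.tm.k₀)
  have h2 := Finset.add_sum_erase ((Finset.univ : Finset M.tm.K).erase M.tm.k₀)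
    (fun k => (c.stk k).length) (Finset.mem_erase.2 ⟨M.kL_ne_k₀, Finset.mem_univ M.kL⟩)
  beta_reduce at h1 h2
  show (∑ k, (c.stk k).length) =
    (∑ k ∈ ((Finset.univ : Finset M.tm.K).erase M.tm.k₀).erase M.kL, (c.stk k).length) + _ + _
  omega

variable {M} in
/-- **Along a space-bounded run the stacks hold at most `S x + |x|` symbols in total**: the work
stacks hold at most `S x` (`RunsInSpace`) and the two input stacks together hold exactly the
input (`IsInputPreserving`). [cite: AroraBarakCC2009, Def. 4.1] -/
theorem stkTotal_le_of_reaches {L : Language Bool} {S : List Bool → ℕ} (hM : DecidesInSpace M L S)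
    (x : List Bool) {c : M.tm.Cfg} (hc : Reaches M.tm.step (M.init x) c) :
    M.stkTotal c.stk ≤ S x + x.length := by
  have hws := (hM.2 x).2 c hc
  have hin := congrArg List.length (hM.1 x c hc)
  simp only [List.length_append, List.length_reverse, List.length_map] at hin
  rw [stkTotal_eq]
  omega

/-- The stack coding of the standard machine preserves the total size. [folklore] -/
theorem sz_encStk_trStk (S : ∀ k, List (M.tm.Γ k)) : sz (encStk (trStk M.tm S)) = M.stkTotal S := by
  letI := M.tm.kFin
  rw [sz, UnivTM2.encStk, List.map_ofFn, List.sum_ofFn]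
  unfold stkTotal
  simp only [comp_def, List.length_map]
  refine Fintype.sum_equiv (eK M.tm).symm _ _ fun k' => ?_
  simp only [TM2Std.trStk, TM2Std.stkCode, List.length_map]

/-! ### The flat presentation of a space machine -/

/-- The code of an input letter `b`: the number of the symbol `inputAlphabet⁻¹ b` of the input
stack in the standard machine. [folklore] -/
noncomputable def symCode (b : Bool) : ℕ := (enc M.tm ⟨M.tm.k₀, M.inputAlphabet.symm b⟩).val

/-- The accepting output symbol: the number of the symbol `outputAlphabet⁻¹ true` of the output
stack. [folklore] -/
noncomputable def accCode : ℕ := (enc M.tm ⟨M.tm.k₁, M.outputAlphabet.symm true⟩).val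

/-- Symbol codes are in the alphabet `Fin (N + 1)`. [folklore] -/
theorem symCode_le (b : Bool) : M.symCode b ≤ (stdCode M.tm).N :=
  Nat.le_of_lt_succ (enc M.tm _).isLt

/-- **The flat code of the initial configuration on `x`**: the entry address of the main label at
the initial state, and the stacks `initStk` (the input stack holds the coded input, the others
are empty). [cite: AroraBarakCC2009, §1.4 (machines as strings)] -/
theorem trCfg_init (x : List Bool) :
    FlatProg.trCfg (stdCode M.tm) (TM2Std.trCfg M.tm (M.init x)) =
      (entry (stdCode M.tm) (stdCode M.tm).main (stdCode M.tm).init,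
        initStk (nK M.tm) (eK M.tm M.tm.k₀).val M.symCode x) := by
  rw [SpaceMachine.init, TM2Std.trCfg_initList, TM2Comp.initList_eq]
  refine Prod.ext rfl ?_
  show encStk (update (fun _ => []) (stdCode M.tm).k₀ (stkCode M.tm M.tm.k₀ (x.map M.inputAlphabet.symm))) = _
  rw [UnivTM2.encStk, initStk]
  congr 1
  funext k
  by_cases hk : k = eK M.tm M.tm.k₀
  · subst hk
    rw [if_pos rfl]
    show ((update (fun _ => ([] : List (Fin (stdN M.tm + 1)))) (eK M.tm M.tm.k₀)
      (stkCode M.tm M.tm.k₀ (x.map M.inputAlphabet.symm))) (eK M.tm M.tm.k₀)).map Fin.val = _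
    rw [update_self, TM2Std.stkCode, List.map_map, List.map_map]
    rfl
  · rw [if_neg (fun h => hk (Fin.ext h))]
    show ((update (fun _ => ([] : List (Fin (stdN M.tm + 1)))) (eK M.tm M.tm.k₀)
      (stkCode M.tm M.tm.k₀ (x.map M.inputAlphabet.symm))) k).map Fin.val = _
    rw [update_of_ne hk, List.map_nil]

/-- Reachability is witnessed by an iteration count (private twin of
`SpaceLoop.exists_iterate_of_reaches`, not imported here). [folklore] -/
private theorem exists_iterate_of_reaches {C : Type} {f : C → Option C} {a b : C}
    (h : Reaches f a b) : ∃ n, (flip bind f)^[n] (some a) = some b := by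
  induction h with
  | refl => exact ⟨0, rfl⟩
  | tail _ hbc ih =>
    obtain ⟨n, hn⟩ := ih
    refine ⟨n + 1, ?_⟩
    rw [iterate_succ_apply', hn]
    exact hbc

/-- A halted configuration has label `none`. [Mathlib `Turing.TM2.step`] [folklore] -/
theorem l_eq_none_of_step {c : M.tm.Cfg} (h : M.tm.step c = none) : c.l = none := by
  obtain ⟨_ | l, v, S⟩ := c
  · rfl
  · cases h

/-- Codes of allowed symbols determine the symbol. [folklore] -/
theorem enc_injective_of_mem {x y : Σ k, M.tm.Γ k} (hx : x ∈ allowed M.tm)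
    (h : enc M.tm x = enc M.tm y) : x = y := by
  unfold TM2Std.enc at h
  rw [dif_pos hx] at h
  by_cases hy : y ∈ allowed M.tm
  · rw [dif_pos hy] at h
    have := (encA M.tm).injective (Fin.succ_injective _ h)
    exact congrArg Subtype.val this
  · rw [dif_neg hy] at h
    exact absurd h (Fin.succ_ne_zero _)

variable {M} in
/-- **The flat run of a space-bounded decider.** If `M` decides `L`, then on every input `x` the
flat program of (the standard machine of) `M`, started on the flat code of the initial
configuration, runs inside the program up to some time `n`, is halted (program counter
`= |program|`) and fixed from time `n` on, and at time `n` its output stack holds the one-symbol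
word `[accCode]` if and only if `x ∈ L`. [cite: AroraBarakCC2009, §1.4 (machines as strings)] -/
theorem flat_halts {L : Language Bool} {S : List Bool → ℕ} (hM : DecidesInSpace M L S)
    (x : List Bool) :
    ∃ n, (∀ m < n, ((step (compile (stdCode M.tm)))^[m]
        (FlatProg.trCfg (stdCode M.tm) (TM2Std.trCfg M.tm (M.init x)))).1 <
          (compile (stdCode M.tm)).length) ∧
      (∀ n', n ≤ n' → (step (compile (stdCode M.tm)))^[n']
        (FlatProg.trCfg (stdCode M.tm) (TM2Std.trCfg M.tm (M.init x))) =
          (step (compile (stdCode M.tm)))^[n]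
            (FlatProg.trCfg (stdCode M.tm) (TM2Std.trCfg M.tm (M.init x)))) ∧
      ((step (compile (stdCode M.tm)))^[n]
        (FlatProg.trCfg (stdCode M.tm) (TM2Std.trCfg M.tm (M.init x)))).1 =
          (compile (stdCode M.tm)).length ∧
      (x ∈ L ↔ ((step (compile (stdCode M.tm)))^[n]
        (FlatProg.trCfg (stdCode M.tm) (TM2Std.trCfg M.tm (M.init x)))).2.getD
          (eK M.tm M.tm.k₁).val [] = [M.accCode]) := by
  unfold SpaceMachine.init
  obtain ⟨cf, hev, hout⟩ := (hM.2 x).1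
  obtain ⟨hreach, hnone⟩ := mem_eval.1 hev
  obtain ⟨t, ht⟩ := exists_iterate_of_reaches hreach
  obtain ⟨hrun, hok⟩ := TM2Std.iterate_tr M.tm t _ _ (TM2Std.stkOK_initList M.tm _) ht
  obtain ⟨n, -, hn, hlt⟩ := FlatProg.exists_iterate_of_iterate (stdCode M.tm) t hrun
  have hl : (TM2Std.trCfg M.tm cf).l = none := by
    show cf.l.map _ = none
    rw [M.l_eq_none_of_step hnone]; rfl
  have hnone' : (stdCode M.tm).tm.step (TM2Std.trCfg M.tm cf) = none :=
    (FlatProg.step_eq_none_iff (stdCode M.tm) _).2 hl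
  have hpc : (FlatProg.trCfg (stdCode M.tm) (TM2Std.trCfg M.tm cf)).1 =
      (compile (stdCode M.tm)).length := by
    rw [length_compile]; exact FlatProg.trCfg_fst_of_none (stdCode M.tm) hl
  refine ⟨n, fun m hm => by rw [length_compile]; exact hlt m hm, fun n' hn' => ?_, by rw [hn, hpc], ?_⟩
  · obtain ⟨d, rfl⟩ := Nat.exists_eq_add_of_le hn'
    rw [add_comm n d, iterate_add_apply, hn]
    exact iterate_step_of_le (by rw [hpc]) d
  · -- the output stack
    rw [hn, FlatProg.trCfg_snd]
    have hk : (encStk (TM2Std.trCfg M.tm cf).stk).getD (eK M.tm M.tm.k₁).val [] =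
        (cf.stk M.tm.k₁).map fun γ => (enc M.tm ⟨M.tm.k₁, γ⟩).val := by
      show (encStk (trStk M.tm cf.stk)).getD (eK M.tm M.tm.k₁).val [] = _
      rw [encStk_getD, TM2Std.trStk_apply, TM2Std.stkCode, List.map_map]
      rfl
    rw [hk]
    have hcf : cf.stk M.tm.k₁ = [M.outputAlphabet.symm (L.boolIndicator x)] := by
      have := congrArg (List.map M.outputAlphabet.symm) hout
      rw [List.map_map, M.outputAlphabet.symm_comp_self, List.map_id] at this
      rw [this]; rfl
    rw [hcf, List.map_singleton, List.cons.injEq, accCode]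
    simp only [and_true]
    constructor
    · intro hx
      rw [(Set.mem_iff_boolIndicator L x).1 hx]
    · intro h
      by_contra hx
      rw [(Set.notMem_iff_boolIndicator L x).1 hx] at h
      have hallowed : (⟨M.tm.k₁, M.outputAlphabet.symm false⟩ : Σ k, M.tm.Γ k) ∈ allowed M.tm := by
        apply hok M.tm.k₁
        rw [hcf, (Set.notMem_iff_boolIndicator L x).1 hx]
        exact List.mem_singleton_self _
      have := M.enc_injective_of_mem hallowed (Fin.ext h)
      have := M.outputAlphabet.symm.injective (eq_of_heq (Sigma.mk.inj_iff.1 this).2)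
      exact Bool.false_ne_true this

variable {M} in
/-- **Size of the flat run of a space-bounded decider**: every flat configuration reached from the
code of the initial configuration on `x` holds at most `S x + |x| + |program|` symbols.
[cite: AroraBarakCC2009, Def. 4.1 and Thm. 4.2] -/
theorem sz_flat_le {L : Language Bool} {S : List Bool → ℕ} (hM : DecidesInSpace M L S)
    (x : List Bool) (m : ℕ) :
    sz ((step (compile (stdCode M.tm)))^[m]
      (FlatProg.trCfg (stdCode M.tm) (TM2Std.trCfg M.tm (M.init x)))).2 ≤
        S x + x.length + (compile (stdCode M.tm)).length := by
  refine FlatProg.sz_iterate_trCfg_le (stdCode M.tm) (fun e he => ?_) m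
  -- `e` is the code of a configuration of `M` reachable from the initial one
  obtain ⟨t, ht⟩ := exists_iterate_of_reaches he
  -- transport the standard run back: the standard machine simulates `M` step for step, and a
  -- run of the standard machine from a coded configuration stays on coded configurations
  suffices h : ∀ (t : ℕ) (a : M.tm.Cfg) (e : (stdCode M.tm).tm.Cfg), Reaches M.tm.step (M.init x) a →
      StkOK M.tm a.stk →
      (flip bind (stdCode M.tm).tm.step)^[t] (some (TM2Std.trCfg M.tm a)) = some e →
      ∃ a' : M.tm.Cfg, Reaches M.tm.step (M.init x) a' ∧ e = TM2Std.trCfg M.tm a' by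
    obtain ⟨a', ha', rfl⟩ := h t (M.init x) e Relation.ReflTransGen.refl
      (TM2Std.stkOK_initList M.tm _) ht
    show sz (encStk (trStk M.tm a'.stk)) ≤ _
    rw [sz_encStk_trStk]
    exact stkTotal_le_of_reaches hM x ha'
  intro t
  induction t with
  | zero =>
    intro a e ha _ h
    simp only [iterate_zero, id_eq, Option.some.injEq] at h
    exact ⟨a, ha, h.symm⟩
  | succ t ih =>
    intro a e ha hok h
    rw [TM2Comp.iterate_bind_succ] at h
    cases hstep : M.tm.step a with
    | none =>
      have hl : (TM2Std.trCfg M.tm a).l = none := by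
        show a.l.map _ = none
        rw [M.l_eq_none_of_step hstep]; rfl
      rw [(FlatProg.step_eq_none_iff (stdCode M.tm) _).2 hl, TM2Comp.iterate_bind_none] at h
      cases h
    | some a₁ =>
      obtain ⟨h1, h2⟩ := TM2Std.step_tr M.tm a a₁ hok hstep
      rw [h1] at h
      exact ih a₁ e (ha.tail hstep) h2 h

end SpaceMachine

/-! ### Flat witnesses of `PSPACE` languages -/

namespace FlatProg

open Turing TM2Std Function Polynomial _root_.Computability

/-- **A flat presentation of a language `L`**: a flat program `P` on `K` stacks over the symbols
`0, …, N`, an initial program counter, input/output stacks, input letter codes and an accepting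
symbol, such that on every input `x` the run of `P` from `(pc₀, initStk K k₀ code x)` keeps at
most `bound(|x|)` symbols on its stacks, keeps its program counter `≤ |P|`, its symbols `≤ N`
and its `K` stacks, stays inside the program until it halts at some time `n` (program counter
`= |P|`, fixed from then on), and accepts — output stack `k₁` holding `[acc]` at time `n` — iff
`x ∈ L`. This is the machine side of the bounded-halting problem for flat programs; every
`PSPACE` language has one with a polynomial `bound` (`exists_flatWitness`). [cite: AroraBarakCC2009, §1.4 (machines as strings) and Def. 4.1] -/
structure FlatWitness (L : Language Bool) where
  /-- the flat program -/
  P : Prog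
  /-- the number of stacks -/
  K : ℕ
  /-- the symbols are `≤ N` -/
  N : ℕ
  /-- the initial program counter -/
  pc₀ : ℕ
  /-- the input stack -/
  k₀ : ℕ
  /-- the output stack -/
  k₁ : ℕ
  /-- the codes of the input letters -/
  code : Bool → ℕ
  /-- the accepting output symbol -/
  acc : ℕ
  /-- the size bound -/
  bound : Polynomial ℕ
  /-- input letters are coded in the alphabet -/
  code_le : ∀ b, code b ≤ N
  /-- the stacks hold at most `bound |x|` symbols, at all times -/
  sz_le : ∀ x m, sz ((step P)^[m] (pc₀, initStk K k₀ code x)).2 ≤ bound.eval x.length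
  /-- the program counter never exceeds `|P|` -/
  fst_le : ∀ x m, ((step P)^[m] (pc₀, initStk K k₀ code x)).1 ≤ P.length
  /-- the symbols stay `≤ N` -/
  stkBound : ∀ x m, StkBound N ((step P)^[m] (pc₀, initStk K k₀ code x)).2
  /-- there are always `K` stacks -/
  length_eq : ∀ x m, ((step P)^[m] (pc₀, initStk K k₀ code x)).2.length = K
  /-- the run halts, and accepts iff `x ∈ L` -/
  halts : ∀ x, ∃ n, (∀ m < n, ((step P)^[m] (pc₀, initStk K k₀ code x)).1 < P.length) ∧
    (∀ n', n ≤ n' → (step P)^[n'] (pc₀, initStk K k₀ code x) = (step P)^[n] (pc₀, initStk K k₀ code x)) ∧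
    ((step P)^[n] (pc₀, initStk K k₀ code x)).1 = P.length ∧
    (x ∈ L ↔ ((step P)^[n] (pc₀, initStk K k₀ code x)).2.getD k₁ [] = [acc])

/-- **The flat witness of a space-bounded decider** with space bound dominated by a polynomial.
[cite: AroraBarakCC2009, §1.4 and Def. 4.1] -/
noncomputable def flatWitnessOf (M : SpaceMachine Bool Bool) {L : Language Bool} {S : List Bool → ℕ}
    (hM : DecidesInSpace M L S) (p : Polynomial ℕ) (hp : ∀ x, S x ≤ p.eval x.length) :
    FlatWitness L where
  P := compile (stdCode M.tm)
  K := nK M.tm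
  N := (stdCode M.tm).N
  pc₀ := entry (stdCode M.tm) (stdCode M.tm).main (stdCode M.tm).init
  k₀ := (eK M.tm M.tm.k₀).val
  k₁ := (eK M.tm M.tm.k₁).val
  code := M.symCode
  acc := M.accCode
  bound := p + X + C (compile (stdCode M.tm)).length
  code_le := M.symCode_le
  sz_le x m := by
    rw [← M.trCfg_init]
    refine (SpaceMachine.sz_flat_le hM x m).trans ?_
    have := hp x
    simp only [eval_add, eval_X, eval_C]
    omega
  fst_le x m := by rw [← M.trCfg_init]; exact fst_iterate_trCfg_le _ _ m
  stkBound x m := by rw [← M.trCfg_init]; exact stkBound_iterate_trCfg _ _ m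
  length_eq x m := by rw [← M.trCfg_init]; exact length_iterate_trCfg _ _ m
  halts x := by rw [← M.trCfg_init]; exact SpaceMachine.flat_halts hM x

/-- **Every `PSPACE` language has a flat presentation with a polynomial size bound.**
[cite: AroraBarakCC2009, §1.4 (machines as strings), Def. 4.1/4.5 (PSPACE)] -/
theorem exists_flatWitness {L : Language Bool} (hL : L ∈ PSPACE) : Nonempty (FlatWitness L) := by
  obtain ⟨k, hk⟩ := Set.mem_iUnion.1 hL
  obtain ⟨c, M, hM⟩ := hk
  exact ⟨flatWitnessOf M hM (C c * X ^ k + C c) fun x => by simp⟩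

end FlatProg

end Literature.Computability.Complexity
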